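import Summits.AtomisticToContinuum.Crystallization.Theorems.FrustratedLawDichotomyStrainedPatchHomEntryFit
import Summits.AtomisticToContinuum.Crystallization.Theorems.FrustratedLawDichotomyStrainedPatchHomCertTreeHcp

/-!
# ENTRY-COORDINATE hcp leaves for the `HomFloor` certificate: (entries, shuffle) → extended Gram interval map, the hcp half from ONE tree verdict,
# and ★★★ `homFloor_of_entryTrees` — `(H) HomFloor m` from TWO Booleans

decomp-a2c hand-2 g22 (crux `AperiodicFrustratedLawGap`, stmt-AtomisticToContinuum-27623; hcp twin of `…HomEntryGram`, critic row 828 (B) GO).  The hcp leaf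
checker `…HomCertTreeHcp.leafOKH` / `hcpTree_sound` works in the 13 extended Gram coordinates `(⟪U fᵢ, U fⱼ⟫ | ⟪U fᵢ, U t⟫ | ‖U t‖²)`, `f = hexFrame`,
`t = hcpShift + ξ`; the cover root of `…HomPrunedPolar.homFloor_of_prunedBoxSums_selfAdjoint` (hcp family) is the 12-coordinate cube of ENTRIES of a
self-adjoint positive `U` (`|u_ab − δ_ab| ≤ 1/4`) and SHUFFLE coordinates (`|ξᵢ| ≤ 1/4`).  This module closes that gap:

* §1 the irrational frame constants `√3`, `√(8/3)`, `√(2/3)` in the `Numerics.FI` kernel and the real component formulas of `U fᵢ`, `U t`;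
* §2 the interval map `extFI` (entries `E`, shuffle `X` ↦ 13 extended Gram intervals), `extC / extW`, ★ `ext_mem_box` (exactly `hcpTree_sound`'s hbox);
* §3 the hcp entry-leaf verdict `entryLeafOKHc μ c w := asymOK ∨ colOutOK ∨ leafOKH μ (extC c w) (extW c w)` (the two free prunes of `…HomEntryGram` act on
  the `U` block), ★ its soundness, the generic ★★ `hcpHalf_of_entryTree` (ANY sound verdict + `treeOK verdict t rootCH rootWH = true` ⟹ the hcp hypothesis
  `hhcp` of `homFloor_of_prunedBoxSums_selfAdjoint` VERBATIM), its instance, and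
* §4 ★★★ `homFloor_of_entryTrees : 2(m + e_W)SC ≤ μ → treeOK (entryLeafOKF μ) tF rootC rootW = true → treeOK (entryLeafOKHc μ) tH rootCH rootWH = true →
  HomFloor m` — the (H) piece of the 27623 T-side line of record from two kernel- or natively-evaluable Booleans.

All definitions computable; 0 sorry; standard axioms; no instances / notation.  `--supports stmt-AtomisticToContinuum-27623`.
-/

namespace Summit.AtomisticToContinuum.Crystallization.Theorems.FrustratedLawDichotomyStrainedPatchHomEntryGramHcp

open scoped BigOperators RealInnerProductSpace
open Literature.Analysis.ValidatedNumerics.Numerics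
open Summit.AtomisticToContinuum.Crystallization.Theorems.ChargedEnergyGapNegative (E3)
open Summit.AtomisticToContinuum.Crystallization.Theorems.FrustratedLawDichotomySchurCut (effPot w₄₅ ω₄)
open Summit.AtomisticToContinuum.Crystallization.Theorems.FrustratedLawDichotomyAveragingRuleTightFree (TightNearCap BadNearCap)
open Summit.AtomisticToContinuum.Crystallization.Theorems.FrustratedLawDichotomyExemptAbsorption (ExemptNear)
open Summit.AtomisticToContinuum.Crystallization.Theorems.FrustratedLawDichotomyStrainedPatchHomSplit
open Summit.AtomisticToContinuum.Crystallization.Theorems.FrustratedLawDichotomyStrainedPatchHomCoords (apply_eq_sum_entries)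
open Summit.AtomisticToContinuum.Crystallization.Theorems.FrustratedLawDichotomyStrainedPatchHomLeafCalculus (inner_eq_sum_apply)
open Summit.AtomisticToContinuum.Crystallization.Theorems.FrustratedLawDichotomyStrainedPatchHomCover (entries_mem_rootCube shuffle_mem_rootCube)
open Summit.AtomisticToContinuum.Crystallization.Theorems.FrustratedLawDichotomyStrainedPatchHomPrunedPolar (homFloor_of_prunedBoxSums_selfAdjoint)
open Summit.AtomisticToContinuum.Crystallization.Theorems.FrustratedLawDichotomyStrainedPatchHomCertTree (CertTree treeOK treeOK_sound)
open Summit.AtomisticToContinuum.Crystallization.Theorems.FrustratedLawDichotomyStrainedPatchHomCertTreeHcp (leafOKH leafOKH_sound)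
open Summit.AtomisticToContinuum.Crystallization.Theorems.FrustratedLawDichotomyStrainedPatchHomEntryGram
open Summit.AtomisticToContinuum.Crystallization.Theorems.FrustratedLawDichotomyStrainedPatchHomEntryFit (entryLeafOKF fccHalf_of_entryFitTree)
open Literature.Barriers.AtomisticToContinuum.FlatleyTheil2015 (fccVec)

/-! ## §1. Frame constants in the kernel; components of `U fᵢ` and `U t` -/

/-- `√3`. -/
def s3 : FI := FI.sqrt (FI.ofInt 3)
/-- `√(8/3)` (the hcp `c`-axis). -/
def s83 : FI := FI.sqrt (FI.ofFrac 8 3)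
/-- `√(2/3)` (the `B`-layer height). -/
def s23 : FI := FI.sqrt (FI.ofFrac 2 3)

/-- [formal bookkeeping] -/
theorem mem_s3 : FI.mem (Real.sqrt 3) s3 := FI.mem_sqrt (by simpa using FI.mem_ofInt 3)
/-- [formal bookkeeping] -/
theorem mem_s83 : FI.mem (Real.sqrt (8 / 3)) s83 :=
  FI.mem_sqrt (by have h := FI.mem_ofFrac 8 (q := 3) (by norm_num); norm_num at h; exact h)
/-- [formal bookkeeping] -/
theorem mem_s23 : FI.mem (Real.sqrt (2 / 3)) s23 :=
  FI.mem_sqrt (by have h := FI.mem_ofFrac 2 (q := 3) (by norm_num); norm_num at h; exact h)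
/-- [formal bookkeeping] -/
theorem mem_half : FI.mem ((1 : ℝ) / 2) (FI.ofFrac 1 2) := by
  have h := FI.mem_ofFrac 1 (q := 2) (by norm_num); norm_num at h; exact h

/-- Components of the hexagonal frame. [formal bookkeeping] -/
theorem hexFrame_apply₀ (b : Fin 3) : hexFrame 0 b = if b = 0 then (1 : ℝ) else 0 := by fin_cases b <;> simp [hexFrame]
/-- [formal bookkeeping] -/
theorem hexFrame_apply₁ (b : Fin 3) : hexFrame 1 b = if b = 0 then (1 : ℝ) / 2 else if b = 1 then Real.sqrt 3 / 2 else 0 := by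
  fin_cases b <;> simp [hexFrame]
/-- [formal bookkeeping] -/
theorem hexFrame_apply₂ (b : Fin 3) : hexFrame 2 b = if b = 2 then Real.sqrt (8 / 3) else 0 := by fin_cases b <;> simp [hexFrame]
/-- [formal bookkeeping] -/
theorem hcpShift_apply (b : Fin 3) : hcpShift b = if b = 0 then (1 : ℝ) / 2 else if b = 1 then Real.sqrt 3 / 6 else Real.sqrt (2 / 3) := by
  fin_cases b <;> simp [hcpShift]

/-- `(U f₀)ₐ = u_a0`, `(U f₁)ₐ = u_a0/2 + (√3/2) u_a1`, `(U f₂)ₐ = √(8/3) u_a2` (`u_ab = (U e_b) a`). [folklore] -/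
theorem apply_hexFrame_eq (U : E3 →L[ℝ] E3) (a : Fin 3) :
    (U (hexFrame 0)) a = (U (EuclideanSpace.single 0 (1 : ℝ))) a ∧
    (U (hexFrame 1)) a = (U (EuclideanSpace.single 0 (1 : ℝ))) a / 2 + Real.sqrt 3 / 2 * (U (EuclideanSpace.single 1 (1 : ℝ))) a ∧
    (U (hexFrame 2)) a = Real.sqrt (8 / 3) * (U (EuclideanSpace.single 2 (1 : ℝ))) a := by
  refine ⟨?_, ?_, ?_⟩
  · rw [apply_eq_sum_entries]; simp only [hexFrame_apply₀, Fin.sum_univ_three]; simp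
  · rw [apply_eq_sum_entries]; simp only [hexFrame_apply₁, Fin.sum_univ_three]; simp; ring
  · rw [apply_eq_sum_entries]; simp only [hexFrame_apply₂, Fin.sum_univ_three]; simp; ring

/-- `(U (hcpShift + ξ))ₐ = u_a0 (1/2 + ξ₀) + u_a1 (√3/6 + ξ₁) + u_a2 (√(2/3) + ξ₂)`. [folklore] -/
theorem apply_shift_eq (U : E3 →L[ℝ] E3) (ξ : E3) (a : Fin 3) :
    (U (hcpShift + ξ)) a = (U (EuclideanSpace.single 0 (1 : ℝ))) a * (1 / 2 + ξ 0) + (U (EuclideanSpace.single 1 (1 : ℝ))) a * (Real.sqrt 3 / 6 + ξ 1) +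
      (U (EuclideanSpace.single 2 (1 : ℝ))) a * (Real.sqrt (2 / 3) + ξ 2) := by
  rw [apply_eq_sum_entries]
  simp only [Fin.sum_univ_three, PiLp.add_apply, hcpShift_apply]
  simp

/-! ## §2. The interval map (entries, shuffle) → extended Gram data -/

/-- Shuffle interval of coordinate `i`: `[c − w, c + w]` (scaled). -/
def shufFI (c w : (Fin 3 × Fin 3) ⊕ Fin 3 → ℤ) (i : Fin 3) : FI := ⟨c (Sum.inr i) - w (Sum.inr i), c (Sum.inr i) + w (Sum.inr i)⟩

/-- Centre/half-width membership ⟹ kernel membership (shuffle). [formal bookkeeping] -/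
theorem mem_shufFI {x : ℝ} {c w : (Fin 3 × Fin 3) ⊕ Fin 3 → ℤ} {i : Fin 3} (h : |x - (c (Sum.inr i) : ℝ) / SC| ≤ (w (Sum.inr i) : ℝ) / SC) :
    FI.mem x (shufFI c w i) :=
  mem_entryFI (c := fun ab : Fin 3 × Fin 3 => c (Sum.inr ab.1)) (w := fun ab : Fin 3 × Fin 3 => w (Sum.inr ab.1)) (ab := (i, 0)) h

/-- `(U fᵢ)ₐ` in the kernel. -/
def uF (E : Fin 3 × Fin 3 → FI) (i a : Fin 3) : FI :=
  if i = 0 then E (a, 0) else if i = 1 then ((E (a, 0)).divNat 2).add ((s3.divNat 2).mul (E (a, 1))) else s83.mul (E (a, 2))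

/-- `(U t)ₐ`, `t = hcpShift + ξ`, in the kernel. -/
def uT (E : Fin 3 × Fin 3 → FI) (X : Fin 3 → FI) (a : Fin 3) : FI :=
  (((E (a, 0)).mul ((FI.ofFrac 1 2).add (X 0))).add ((E (a, 1)).mul ((s3.divNat 6).add (X 1)))).add ((E (a, 2)).mul (s23.add (X 2)))

/-- Dot product over the three components. -/
def dot3 (A B : Fin 3 → FI) : FI := (((A 0).mul (B 0)).add ((A 1).mul (B 1))).add ((A 2).mul (B 2))

/-- The 13 extended Gram intervals. -/
def extFI (E : Fin 3 × Fin 3 → FI) (X : Fin 3 → FI) : (Fin 3 × Fin 3) ⊕ (Fin 3 ⊕ Fin 1) → FI :=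
  Sum.elim (fun ij => dot3 (uF E ij.1) (uF E ij.2)) (Sum.elim (fun i => dot3 (uF E i) (uT E X)) (fun _ => dot3 (uT E X) (uT E X)))

/-- Extended-Gram box CENTRE of the entry/shuffle box `(c, w)`. -/
def extC (c w : (Fin 3 × Fin 3) ⊕ Fin 3 → ℤ) : (Fin 3 × Fin 3) ⊕ (Fin 3 ⊕ Fin 1) → ℤ := fun k =>
  cen (extFI (entryFI (fun ab => c (Sum.inl ab)) (fun ab => w (Sum.inl ab))) (shufFI c w) k)

/-- Extended-Gram box HALF-WIDTHS of the entry/shuffle box `(c, w)`. -/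
def extW (c w : (Fin 3 × Fin 3) ⊕ Fin 3 → ℤ) : (Fin 3 × Fin 3) ⊕ (Fin 3 ⊕ Fin 1) → ℤ := fun k =>
  rad (extFI (entryFI (fun ab => c (Sum.inl ab)) (fun ab => w (Sum.inl ab))) (shufFI c w) k)

/-- `uF` encloses `(U fᵢ)ₐ`. [formal bookkeeping] -/
theorem mem_uF (U : E3 →L[ℝ] E3) {E : Fin 3 × Fin 3 → FI} (h : ∀ ab : Fin 3 × Fin 3, FI.mem ((U (EuclideanSpace.single ab.2 (1 : ℝ))) ab.1) (E ab))
    (i a : Fin 3) : FI.mem ((U (hexFrame i)) a) (uF E i a) := by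
  obtain ⟨e0, e1, e2⟩ := apply_hexFrame_eq U a
  have h0 : FI.mem ((U (hexFrame 0)) a) (uF E 0 a) := by
    rw [e0]; exact h (a, 0)
  have h1 : FI.mem ((U (hexFrame 1)) a) (uF E 1 a) := by
    rw [e1]
    show FI.mem _ (((E (a, 0)).divNat 2).add ((s3.divNat 2).mul (E (a, 1))))
    have h1' : FI.mem (Real.sqrt 3 / 2 * (U (EuclideanSpace.single 1 (1 : ℝ))) a) ((s3.divNat 2).mul (E (a, 1))) :=
      FI.mem_mul (by simpa using FI.mem_divNat mem_s3 (n := 2) (by norm_num)) (h (a, 1))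
    exact FI.mem_add (by simpa using FI.mem_divNat (h (a, 0)) (n := 2) (by norm_num)) h1'
  have h2 : FI.mem ((U (hexFrame 2)) a) (uF E 2 a) := by
    rw [e2]
    show FI.mem _ (s83.mul (E (a, 2)))
    exact FI.mem_mul mem_s83 (h (a, 2))
  fin_cases i
  · exact h0
  · exact h1
  · exact h2

/-- `uT` encloses `(U t)ₐ`. [formal bookkeeping] -/
theorem mem_uT (U : E3 →L[ℝ] E3) (ξ : E3) {E : Fin 3 × Fin 3 → FI} {X : Fin 3 → FI}
    (h : ∀ ab : Fin 3 × Fin 3, FI.mem ((U (EuclideanSpace.single ab.2 (1 : ℝ))) ab.1) (E ab)) (hX : ∀ i, FI.mem (ξ i) (X i)) (a : Fin 3) :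
    FI.mem ((U (hcpShift + ξ)) a) (uT E X a) := by
  rw [apply_shift_eq]
  have h6 : FI.mem (Real.sqrt 3 / 6) (s3.divNat 6) := by simpa using FI.mem_divNat mem_s3 (n := 6) (by norm_num)
  exact FI.mem_add (FI.mem_add (FI.mem_mul (h (a, 0)) (FI.mem_add mem_half (hX 0))) (FI.mem_mul (h (a, 1)) (FI.mem_add h6 (hX 1))))
    (FI.mem_mul (h (a, 2)) (FI.mem_add mem_s23 (hX 2)))

/-- `dot3` encloses `⟪x, y⟫`. [formal bookkeeping] -/
theorem mem_dot3 {x y : E3} {A B : Fin 3 → FI} (hx : ∀ a, FI.mem (x a) (A a)) (hy : ∀ a, FI.mem (y a) (B a)) : FI.mem ⟪x, y⟫ (dot3 A B) := by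
  rw [inner_eq_sum_apply, Fin.sum_univ_three]
  exact FI.mem_add (FI.mem_add (FI.mem_mul (hx 0) (hy 0)) (FI.mem_mul (hx 1) (hy 1))) (FI.mem_mul (hx 2) (hy 2))

/-- ★ **INTERVAL MAP**: entries of `U` and coordinates of `ξ` in the box `(c, w)` ⟹ the 13 extended Gram data (`f = hexFrame`, `t = hcpShift + ξ`) in the box
`(extC c w, extW c w)`, in the exact hypothesis shape of `…HomCertTreeHcp.hcpTree_sound` / `leafOKH_sound`. [folklore] -/
theorem ext_mem_box (U : E3 →L[ℝ] E3) (ξ : E3) {c w : (Fin 3 × Fin 3) ⊕ Fin 3 → ℤ}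
    (hbox : ∀ ab : Fin 3 × Fin 3, |(U (EuclideanSpace.single ab.2 (1 : ℝ))) ab.1 - (c (Sum.inl ab) : ℝ) / SC| ≤ (w (Sum.inl ab) : ℝ) / SC)
    (hξ : ∀ i : Fin 3, |ξ i - (c (Sum.inr i) : ℝ) / SC| ≤ (w (Sum.inr i) : ℝ) / SC) (k : (Fin 3 × Fin 3) ⊕ (Fin 3 ⊕ Fin 1)) :
    |(Sum.elim (fun ij : Fin 3 × Fin 3 => ⟪U (hexFrame ij.1), U (hexFrame ij.2)⟫)
        (Sum.elim (fun i : Fin 3 => ⟪U (hexFrame i), U (hcpShift + ξ)⟫) (fun _ => ‖U (hcpShift + ξ)‖ ^ 2)) k) - (extC c w k : ℝ) / SC| ≤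
      (extW c w k : ℝ) / SC := by
  have hE : ∀ ab : Fin 3 × Fin 3, FI.mem ((U (EuclideanSpace.single ab.2 (1 : ℝ))) ab.1)
      (entryFI (fun ab => c (Sum.inl ab)) (fun ab => w (Sum.inl ab)) ab) := fun ab => mem_entryFI (hbox ab)
  have hX : ∀ i, FI.mem (ξ i) (shufFI c w i) := fun i => mem_shufFI (hξ i)
  have hF := mem_uF U hE
  have hT := mem_uT U ξ hE hX
  rcases k with ij | i | o
  · exact abs_sub_cen_le (mem_dot3 (hF ij.1) (hF ij.2))
  · exact abs_sub_cen_le (mem_dot3 (hF i) hT)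
  · have : FI.mem (‖U (hcpShift + ξ)‖ ^ 2) (dot3 (uT (entryFI (fun ab => c (Sum.inl ab)) (fun ab => w (Sum.inl ab))) (shufFI c w))
        (uT (entryFI (fun ab => c (Sum.inl ab)) (fun ab => w (Sum.inl ab))) (shufFI c w))) := by
      rw [← real_inner_self_eq_norm_sq]; exact mem_dot3 hT hT
    exact abs_sub_cen_le this

/-! ## §3. The hcp entry-leaf verdict and the hcp half from one tree verdict -/

/-- ★ **hcp ENTRY-LEAF VERDICT**: symmetry prune ∨ column prune (on the `U` block) ∨ the hcp leaf checker (P4) on the mapped box. -/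
def entryLeafOKHc (μ : ℤ) (c w : (Fin 3 × Fin 3) ⊕ Fin 3 → ℤ) : Bool :=
  asymOK (fun ab => c (Sum.inl ab)) (fun ab => w (Sum.inl ab)) || colOutOK (fun ab => c (Sum.inl ab)) (fun ab => w (Sum.inl ab)) ||
    leafOKH μ (extC c w) (extW c w)

/-- ★ Soundness of `entryLeafOKHc`: for every self-adjoint `U` with `‖U − 1‖ ≤ 1/4` and every `ξ` whose coordinates lie in the box, the prune disjunct holds
or `μ/SC ≤ Σ_b W₄₅‖latPt U hexFrame b‖ + Σ_b W₄₅‖latPt U hexFrame b + U(hcpShift + ξ)‖`. [folklore] -/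
theorem entryLeafOKHc_sound {μ : ℤ} {c w : (Fin 3 × Fin 3) ⊕ Fin 3 → ℤ} (h : entryLeafOKHc μ c w = true) (U : E3 →L[ℝ] E3) (ξ : E3)
    (hsa : ∀ v v' : E3, ⟪U v, v'⟫ = ⟪v, U v'⟫) (hU : ‖U - 1‖ ≤ 1 / 4)
    (hbox : ∀ ab : Fin 3 × Fin 3, |(U (EuclideanSpace.single ab.2 (1 : ℝ))) ab.1 - (c (Sum.inl ab) : ℝ) / SC| ≤ (w (Sum.inl ab) : ℝ) / SC)
    (hξ : ∀ i : Fin 3, |ξ i - (c (Sum.inr i) : ℝ) / SC| ≤ (w (Sum.inr i) : ℝ) / SC) :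
    (∀ (M : ℕ) (z : Fin M → E3) (c : Fin M), Function.Injective z →
        Set.range z = {x : E3 | dist x (z c) ≤ 133 / 10 ∧ ∃ a : Fin 3 → ℤ,
          x = z c + latPt U hexFrame a ∨ x = z c + latPt U hexFrame a + U (hcpShift + ξ)} →
        TightNearCap (9 / 5) (3 / 2) z c ∨ ExemptNear (9 / 5) ExRec z c ∨ BadNearCap (9 / 5) (3 / 2) z c) ∨
      (μ : ℝ) / SC ≤ ∑ b ∈ (Fintype.piFinset fun _ : Fin 3 => Finset.Icc (-7 : ℤ) 7).filter (fun b => b ≠ 0), effPot w₄₅ ω₄ (3 / 400) ‖latPt U hexFrame b‖ +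
        ∑ b ∈ (Fintype.piFinset fun _ : Fin 3 => Finset.Icc (-7 : ℤ) 7), effPot w₄₅ ω₄ (3 / 400) ‖latPt U hexFrame b + U (hcpShift + ξ)‖ := by
  simp only [entryLeafOKHc, Bool.or_eq_true] at h
  rcases h with (h | h) | h
  · have hsym : ∀ a b : Fin 3, (U (EuclideanSpace.single b (1 : ℝ))) a = (U (EuclideanSpace.single a (1 : ℝ))) b := fun a b => by
      have e1 : (U (EuclideanSpace.single b (1 : ℝ))) a = ⟪EuclideanSpace.single a (1 : ℝ), U (EuclideanSpace.single b (1 : ℝ))⟫ := by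
        rw [EuclideanSpace.inner_single_left]; simp
      have e2 : (U (EuclideanSpace.single a (1 : ℝ))) b = ⟪EuclideanSpace.single b (1 : ℝ), U (EuclideanSpace.single a (1 : ℝ))⟫ := by
        rw [EuclideanSpace.inner_single_left]; simp
      rw [e1, e2, ← hsa, real_inner_comm]
    exact (false_of_asymOK h (u := fun ab : Fin 3 × Fin 3 => (U (EuclideanSpace.single ab.2 (1 : ℝ))) ab.1) (fun a b => hsym a b) hbox).elim
  · exact (false_of_colOutOK h U hU hbox).elim
  · exact Or.inr (leafOKH_sound h hexFrame U (hcpShift + ξ) (ext_mem_box U ξ hbox hξ))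

/-- Root CENTRE of the hcp entry/shuffle cube: `(SC·δ | 0)`. -/
def rootCH : (Fin 3 × Fin 3) ⊕ Fin 3 → ℤ := Sum.elim rootC (fun _ => 0)

/-- Root HALF-WIDTH of the hcp entry/shuffle cube: `SC/4` on all 12 coordinates. -/
def rootWH : (Fin 3 × Fin 3) ⊕ Fin 3 → ℤ := fun _ => 70368744177664

/-- ★★ **THE hcp HALF FROM ONE TREE VERDICT (generic leaf verdict).**  A leaf verdict sound in the sense of `entryLeafOKHc_sound` plus
`treeOK verdict t rootCH rootWH = true` gives the hcp hypothesis `hhcp` of `…HomPrunedPolar.homFloor_of_prunedBoxSums_selfAdjoint` VERBATIM for every `m` with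
`2 (m + e_W) · SC ≤ μ`. [folklore] -/
theorem hcpHalf_of_entryTree {m : ℝ} {μ : ℤ} (hμ : 2 * (m + (-(7175 / 10000) + 3 / 400)) * SC ≤ μ)
    (verdict : ((Fin 3 × Fin 3) ⊕ Fin 3 → ℤ) → ((Fin 3 × Fin 3) ⊕ Fin 3 → ℤ) → Bool)
    (hver : ∀ c w, verdict c w = true → ∀ (U : E3 →L[ℝ] E3) (ξ : E3), (∀ v v' : E3, ⟪U v, v'⟫ = ⟪v, U v'⟫) → ‖U - 1‖ ≤ 1 / 4 →
      (∀ ab : Fin 3 × Fin 3, |(U (EuclideanSpace.single ab.2 (1 : ℝ))) ab.1 - (c (Sum.inl ab) : ℝ) / SC| ≤ (w (Sum.inl ab) : ℝ) / SC) →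
      (∀ i : Fin 3, |ξ i - (c (Sum.inr i) : ℝ) / SC| ≤ (w (Sum.inr i) : ℝ) / SC) →
      (∀ (M : ℕ) (z : Fin M → E3) (c : Fin M), Function.Injective z →
          Set.range z = {x : E3 | dist x (z c) ≤ 133 / 10 ∧ ∃ a : Fin 3 → ℤ,
            x = z c + latPt U hexFrame a ∨ x = z c + latPt U hexFrame a + U (hcpShift + ξ)} →
          TightNearCap (9 / 5) (3 / 2) z c ∨ ExemptNear (9 / 5) ExRec z c ∨ BadNearCap (9 / 5) (3 / 2) z c) ∨
        (μ : ℝ) / SC ≤ ∑ b ∈ (Fintype.piFinset fun _ : Fin 3 => Finset.Icc (-7 : ℤ) 7).filter (fun b => b ≠ 0), effPot w₄₅ ω₄ (3 / 400) ‖latPt U hexFrame b‖ +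
          ∑ b ∈ (Fintype.piFinset fun _ : Fin 3 => Finset.Icc (-7 : ℤ) 7), effPot w₄₅ ω₄ (3 / 400) ‖latPt U hexFrame b + U (hcpShift + ξ)‖)
    {t : CertTree ((Fin 3 × Fin 3) ⊕ Fin 3)} (h : treeOK verdict t rootCH rootWH = true) :
    ∀ (U : E3 →L[ℝ] E3) (ξ : E3), (∀ v w : E3, inner ℝ (U v) w = inner ℝ v (U w)) → (∀ w : E3, 0 ≤ inner ℝ w (U w)) →
      ‖U - 1‖ ≤ 1 / 4 → ‖ξ‖ ≤ 1 / 4 →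
      (∀ (M : ℕ) (z : Fin M → E3) (c : Fin M), Function.Injective z →
          Set.range z = {x : E3 | dist x (z c) ≤ 133 / 10 ∧ ∃ a : Fin 3 → ℤ,
            x = z c + latPt U hexFrame a ∨ x = z c + latPt U hexFrame a + U (hcpShift + ξ)} →
          TightNearCap (9 / 5) (3 / 2) z c ∨ ExemptNear (9 / 5) ExRec z c ∨ BadNearCap (9 / 5) (3 / 2) z c) ∨
      m ≤ (∑ b ∈ (Fintype.piFinset fun _ : Fin 3 => Finset.Icc (-7 : ℤ) 7).filter (fun b => b ≠ 0),
          effPot w₄₅ ω₄ (3 / 400) ‖latPt U hexFrame b‖ +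
        ∑ b ∈ (Fintype.piFinset fun _ : Fin 3 => Finset.Icc (-7 : ℤ) 7),
          effPot w₄₅ ω₄ (3 / 400) ‖latPt U hexFrame b + U (hcpShift + ξ)‖) / 2 - (-(7175 / 10000) + 3 / 400) := by
  intro U ξ hsa _hpos hU hξ
  have hS := SC_pos
  have hroot : ∀ k, |(Sum.elim (fun ab : Fin 3 × Fin 3 => (U (EuclideanSpace.single ab.2 (1 : ℝ))) ab.1) (fun i : Fin 3 => ξ i) k) -
      (rootCH k : ℝ) / SC| ≤ (rootWH k : ℝ) / SC := by
    intro k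
    rcases k with ab | i
    · simpa [rootCH, rootWH, rootW] using mem_root_of_near_one hU ab
    · have h := shuffle_mem_rootCube hξ i
      have e1 : (rootCH (Sum.inr i) : ℝ) / SC = 0 := by simp [rootCH]
      rw [Sum.elim_inr, e1, show (rootWH (Sum.inr i) : ℝ) / SC = 1 / 4 from rootW_div]
      exact h
  have key := treeOK_sound SC_pos
    (P := fun x : (Fin 3 × Fin 3) ⊕ Fin 3 → ℝ => ∀ (U : E3 →L[ℝ] E3) (ξ : E3), (∀ v v' : E3, ⟪U v, v'⟫ = ⟪v, U v'⟫) → ‖U - 1‖ ≤ 1 / 4 →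
      (∀ ab : Fin 3 × Fin 3, (U (EuclideanSpace.single ab.2 (1 : ℝ))) ab.1 = x (Sum.inl ab)) → (∀ i : Fin 3, ξ i = x (Sum.inr i)) →
      (∀ (M : ℕ) (z : Fin M → E3) (c : Fin M), Function.Injective z →
          Set.range z = {x : E3 | dist x (z c) ≤ 133 / 10 ∧ ∃ a : Fin 3 → ℤ,
            x = z c + latPt U hexFrame a ∨ x = z c + latPt U hexFrame a + U (hcpShift + ξ)} →
          TightNearCap (9 / 5) (3 / 2) z c ∨ ExemptNear (9 / 5) ExRec z c ∨ BadNearCap (9 / 5) (3 / 2) z c) ∨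
        (μ : ℝ) / SC ≤ ∑ b ∈ (Fintype.piFinset fun _ : Fin 3 => Finset.Icc (-7 : ℤ) 7).filter (fun b => b ≠ 0), effPot w₄₅ ω₄ (3 / 400) ‖latPt U hexFrame b‖ +
          ∑ b ∈ (Fintype.piFinset fun _ : Fin 3 => Finset.Icc (-7 : ℤ) 7), effPot w₄₅ ω₄ (3 / 400) ‖latPt U hexFrame b + U (hcpShift + ξ)‖)
    verdict (fun c w hv x hx V η hVsa hV1 hVx hηx => hver c w hv V η hVsa hV1 (fun ab => by rw [hVx ab]; exact hx (Sum.inl ab))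
      (fun i => by rw [hηx i]; exact hx (Sum.inr i))) t rootCH rootWH h
    (Sum.elim (fun ab : Fin 3 × Fin 3 => (U (EuclideanSpace.single ab.2 (1 : ℝ))) ab.1) (fun i : Fin 3 => ξ i)) hroot U ξ hsa hU
    (fun _ => rfl) (fun _ => rfl)
  refine key.imp id fun hfloor => ?_
  have h2 : 2 * (m + (-(7175 / 10000) + 3 / 400)) ≤ (μ : ℝ) / SC := by rw [le_div_iff₀ hS]; exact hμ
  linarith

/-- ★★ **THE hcp HALF FROM ONE BOOLEAN**: `treeOK (entryLeafOKHc μ) t rootCH rootWH = true` with `2 (m + e_W) SC ≤ μ` ⟹ the hcp hypothesis of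
`homFloor_of_prunedBoxSums_selfAdjoint` for `m`. [folklore] -/
theorem hcpHalf_of_entryLeafTree {m : ℝ} {μ : ℤ} (hμ : 2 * (m + (-(7175 / 10000) + 3 / 400)) * SC ≤ μ)
    {t : CertTree ((Fin 3 × Fin 3) ⊕ Fin 3)} (h : treeOK (entryLeafOKHc μ) t rootCH rootWH = true) :
    ∀ (U : E3 →L[ℝ] E3) (ξ : E3), (∀ v w : E3, inner ℝ (U v) w = inner ℝ v (U w)) → (∀ w : E3, 0 ≤ inner ℝ w (U w)) →
      ‖U - 1‖ ≤ 1 / 4 → ‖ξ‖ ≤ 1 / 4 →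
      (∀ (M : ℕ) (z : Fin M → E3) (c : Fin M), Function.Injective z →
          Set.range z = {x : E3 | dist x (z c) ≤ 133 / 10 ∧ ∃ a : Fin 3 → ℤ,
            x = z c + latPt U hexFrame a ∨ x = z c + latPt U hexFrame a + U (hcpShift + ξ)} →
          TightNearCap (9 / 5) (3 / 2) z c ∨ ExemptNear (9 / 5) ExRec z c ∨ BadNearCap (9 / 5) (3 / 2) z c) ∨
      m ≤ (∑ b ∈ (Fintype.piFinset fun _ : Fin 3 => Finset.Icc (-7 : ℤ) 7).filter (fun b => b ≠ 0),
          effPot w₄₅ ω₄ (3 / 400) ‖latPt U hexFrame b‖ +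
        ∑ b ∈ (Fintype.piFinset fun _ : Fin 3 => Finset.Icc (-7 : ℤ) 7),
          effPot w₄₅ ω₄ (3 / 400) ‖latPt U hexFrame b + U (hcpShift + ξ)‖) / 2 - (-(7175 / 10000) + 3 / 400) :=
  hcpHalf_of_entryTree hμ (entryLeafOKHc μ) (fun _ _ hv U ξ hsa hU hbox hξ => entryLeafOKHc_sound hv U ξ hsa hU hbox hξ) h

/-! ## §4. ★★★ `(H) HomFloor m` from TWO Booleans -/

/-- ★★★ **`HomFloor m` FROM TWO TREE VERDICTS**: with `2 (m + e_W) SC ≤ μ`, an fcc entry tree accepted by `entryLeafOKF μ` ((P1) fit ∨ symmetry ∨ column ∨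
(P4)) over the root cube `(SC·δ, SC/4)` and an hcp entry/shuffle tree accepted by `entryLeafOKHc μ` (symmetry ∨ column ∨ (P4)) over `(SC·δ | 0, SC/4)` give
`HomFloor m` — by `…HomPrunedPolar.homFloor_of_prunedBoxSums_selfAdjoint`.  Both verdicts are computable (`#eval`) and kernel-reducible (`decide`). [folklore] -/
theorem homFloor_of_entryTrees {m : ℝ} {μ : ℤ} (hμ : 2 * (m + (-(7175 / 10000) + 3 / 400)) * SC ≤ μ)
    {tF : CertTree (Fin 3 × Fin 3)} (hF : treeOK (entryLeafOKF μ) tF rootC rootW = true)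
    {tH : CertTree ((Fin 3 × Fin 3) ⊕ Fin 3)} (hH : treeOK (entryLeafOKHc μ) tH rootCH rootWH = true) : HomFloor m :=
  homFloor_of_prunedBoxSums_selfAdjoint (fccHalf_of_entryFitTree hμ hF) (hcpHalf_of_entryLeafTree hμ hH)

/-! ## §5. Kernel smoke tests -/

/-- At the thin root centre (`U = 1`, `ξ = 0`): `⟪f₀, f₀⟫ = 1` exactly; `⟪f₂, f₂⟫ ∋ 8/3`; `‖t‖² ∋ 1` (ideal hcp: `|hcpShift| = 1`); the column prune fires on a
corner box. -/
example : extC rootCH (fun _ => 0) (Sum.inl (0, 0)) = (SC : ℤ) ∧ extW rootCH (fun _ => 0) (Sum.inl (0, 0)) = 0 ∧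
    3 * (extC rootCH (fun _ => 0) (Sum.inl (2, 2)) - extW rootCH (fun _ => 0) (Sum.inl (2, 2))) ≤ 8 * (SC : ℤ) ∧
    8 * (SC : ℤ) ≤ 3 * (extC rootCH (fun _ => 0) (Sum.inl (2, 2)) + extW rootCH (fun _ => 0) (Sum.inl (2, 2))) ∧
    extC rootCH (fun _ => 0) (Sum.inr (Sum.inr 0)) - extW rootCH (fun _ => 0) (Sum.inr (Sum.inr 0)) ≤ (SC : ℤ) ∧
    (SC : ℤ) ≤ extC rootCH (fun _ => 0) (Sum.inr (Sum.inr 0)) + extW rootCH (fun _ => 0) (Sum.inr (Sum.inr 0)) ∧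
    entryLeafOKHc 0 (fun k => rootCH k + 60000000000000) (fun _ => 1000) = true := by
  decide +kernel

end Summit.AtomisticToContinuum.Crystallization.Theorems.FrustratedLawDichotomyStrainedPatchHomEntryGramHcp
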